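import Summits.CriticalPhenomena.PercolationContinuityZ3.Theorems.Transplant.D10SKc10_4522P2
import HarnessLib

/-!
# Diamond film `D_10` — KERNEL CERTIFICATE for the class `10_4522` of `ShapedLinkageX 4 (DiamondFilm.sqShadow (k := 10))`, THE CLASS (mask + coverage from the 2 parts) (template `fullmcp`, |W| = 157, 2162 terminal pairs, 5923 plans)

builds on p205010 (kernel theorem, internal audit signed; external expert review pending) — NOT used in this file.  Lane `prim-bschramm`, seat `prim-bschramm-p2` (gen 43; class C1b;
memo `HOME/bschramm/P2-LATTICES.md` §152); helper file (`--supports stmt-CriticalPhenomena-4575 --as helper`).  Generated by `cert/emit_dk.py` from the plans of `cert/gen_dk.py`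
(canonical BFS routings with avoid hints, exact mirror `cert/kern_dk.py` of «DkSKDefs»); re-checked here by the kernel (`DCtx.checkEs`); `caseOK_k10_10_4522` feeds «D10SKFinal».
[cite: DuminilCopinSidoraviciusTassion2016, §2.3 (proof of Fact 2: the three disjoint paths in B_R(z))]
-/

namespace Summit.CriticalPhenomena.PercolationContinuityZ3.Theorems.Transplant

namespace DiamondFilm.DK

/-- The cleared mask of the class `10_4522` of `D_10` is admissible (inside the cleared block, containing the forced core). [folklore] -/
theorem wOK_k10_10_4522 : DCtx.wOK (⟨10, 1, 0, 4, 5, 2, 2, 9044575358143091461873150477175263544811248005341289561704234694639158797683336801040633558262531910503266485306080608256⟩ : DCtx) = true := by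
  decide +kernel

/-- **THE CLASS `10_4522` OF `D_10` IS COVERED**: every needed bit of every certified terminal pair has a swap-pair plan. [cite: DuminilCopinSidoraviciusTassion2016, §2.3 (proof of Fact 2)] -/
theorem caseOK_k10_10_4522 : CaseOK (⟨10, 1, 0, 4, 5, 2, 2, 9044575358143091461873150477175263544811248005341289561704234694639158797683336801040633558262531910503266485306080608256⟩ : DCtx) :=
  caseOK_of_chunks _ [[14, 15, 16, 17], [18, 37, 43, 61], [85, 91, 110, 111], [112, 113, 114, 158], [159, 160, 161, 162], [169, 175, 181, 193], [205, 217, 229, 241], [247, 254, 255, 256], [257, 258, 303, 305], [313, 319, 325, 337], [349, 361, 373, 385], [391, 399, 401]]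
    (List.forall_mem_cons.2 ⟨checkEs_sound _ _ _ chunk_k10_10_4522_0, List.forall_mem_cons.2 ⟨checkEs_sound _ _ _ chunk_k10_10_4522_1, List.forall_mem_cons.2 ⟨checkEs_sound _ _ _ chunk_k10_10_4522_2, List.forall_mem_cons.2 ⟨checkEs_sound _ _ _ chunk_k10_10_4522_3, List.forall_mem_cons.2 ⟨checkEs_sound _ _ _ chunk_k10_10_4522_4, List.forall_mem_cons.2 ⟨checkEs_sound _ _ _ chunk_k10_10_4522_5, List.forall_mem_cons.2 ⟨checkEs_sound _ _ _ chunk_k10_10_4522_6, List.forall_mem_cons.2 ⟨checkEs_sound _ _ _ chunk_k10_10_4522_7, List.forall_mem_cons.2 ⟨checkEs_sound _ _ _ chunk_k10_10_4522_8, List.forall_mem_cons.2 ⟨checkEs_sound _ _ _ chunk_k10_10_4522_9, List.forall_mem_cons.2 ⟨checkEs_sound _ _ _ chunk_k10_10_4522_10, List.forall_mem_cons.2 ⟨checkEs_sound _ _ _ chunk_k10_10_4522_11, List.forall_mem_nil _⟩⟩⟩⟩⟩⟩⟩⟩⟩⟩⟩⟩)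
    (by decide +kernel)

end DiamondFilm.DK

end Summit.CriticalPhenomena.PercolationContinuityZ3.Theorems.Transplant
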